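import Summits.SmoothPoincare4.SmoothPoincare4.Theorems.ConvexBisectionAcyclicBisectionExistsChartRegularity
import Summits.SmoothPoincare4.SmoothPoincare4.Theorems.ConvexBisectionAcyclicBisectionExistsPicardLefschetzVariation
import Mathlib.Analysis.Calculus.InverseFunctionTheorem.ContDiff
import HarnessLib

/-!
# Transition maps between two annulus charts of a page
(wave 4, stretch brick Y4-6 = sub-lemma (i) TRANSITION MAPS of the symmetry statement (R1)
`crossingNumber_symm` for the missing lemma `crossingNumber_eq_stdSymp` of node N1a of stub
`stub_modelsOnFibred_of_reach` = NF4, line `modp-braid-orbits`, crux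
`ConvexBisection.AcyclicBisectionExists`, item stmt-SmoothPoincare4-10508; registered sub-goal
`helper_chart_transition`)

Z6-REPORT §3 (R1)(i): near a common point `φ p₀ = ψ q₀` (`q₀` in the open strip) of a smooth map
`φ : ℝ × ℝ → page g c` and an annulus chart `ψ` of the page (smooth, periodic, in the page,
injective on `[0,1) × (−1,1)`, positively oriented) there is a TRANSITION MAP `T` with
`ψ ∘ T = φ` near `p₀`, `T p₀ = q₀`, `T` real `C^∞` at `p₀`, and `DΨ(q₀) ∘ DT(p₀) = DΦ(p₀)`
(`Ψ = val ∘ ψ`, `Φ = val ∘ φ`; **`helper_chart_transition`**).  Consequently the transverse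
coordinate `p ↦ height ψ (φ p)` is `C^∞` at `p₀` and equals `(T p).2` near `p₀`
(`contDiffAt_height_comp_chart`).

Proof: `DΨ(q₀)` is injective (`injective_fderiv_of_chart`, Z6-9), so it has a continuous linear
left inverse `π` (finite dimension); `F = π ∘ Ψ : ℝ² → ℝ²` has `DF(q₀) = id`, hence is a local
diffeomorphism at `q₀` (inverse function theorem, `ContDiffAt.toOpenPartialHomeomorph`); points of
the page near `ψ q₀` are `ψ q` with `q` near `q₀` (`chart_relOpen`, V7), so for `p` near `p₀`,
`φ p = ψ q` and `T p := F⁻¹ (π (Φ p)) = F⁻¹ (F q) = q`.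
Everything is proved; no `sorry`.  References: J. M. Lee, *Introduction to Smooth Manifolds*
(2013), Thm. 4.5, Prop. 5.22 [LeeSmoothManifolds2013].
-/

noncomputable section

set_option linter.dupNamespace false

open scoped Manifold ContDiff Topology
open Set Function Filter
open Literature.Topology.FourManifolds Literature.Topology.FourManifolds.LefschetzBase

namespace Summit.SmoothPoincare4.SmoothPoincare4.Theorems.AcyclicBisectionExists.ModpBraidOrbits

variable {g : ℕ} {c : ℂ} {φ ψ : ℝ × ℝ → Base g}

/-- **An injective continuous linear map out of `ℝ²` has a continuous linear left inverse.**
[folklore] -/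
theorem exists_leftInverse_clm (L : (ℝ × ℝ) →L[ℝ] EuclideanSpace ℝ (Fin 4)) (hL : Injective L) :
    ∃ π : EuclideanSpace ℝ (Fin 4) →L[ℝ] (ℝ × ℝ), ∀ v, π (L v) = v := by
  obtain ⟨G, hG⟩ := (L : (ℝ × ℝ) →ₗ[ℝ] EuclideanSpace ℝ (Fin 4)).exists_leftInverse_of_injective
    (LinearMap.ker_eq_bot.2 hL)
  refine ⟨LinearMap.toContinuousLinearMap G, fun v => ?_⟩
  have := congrArg (fun f : (ℝ × ℝ) →ₗ[ℝ] (ℝ × ℝ) => f v) hG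
  simpa using this

/-- **Transition maps between a smooth page map and an annulus chart** ((R1)(i) of Z6 §3).
[cite: LeeSmoothManifolds2013, Thm. 4.5] -/
theorem exists_transition (hc : ‖c‖ = 1) (hφs : ContMDiff 𝓘(ℝ, ℝ × ℝ) (𝓡∂ 4) ∞ φ)
    (hφp : ∀ p, φ p ∈ page g c) (hψs : ContMDiff 𝓘(ℝ, ℝ × ℝ) (𝓡∂ 4) ∞ ψ)
    (hψ1 : ∀ u r, ψ (u + 1, r) = ψ (u, r)) (hψp : ∀ p, ψ p ∈ page g c)
    (hψi : InjOn ψ (Ico (0 : ℝ) 1 ×ˢ Ioo (-1 : ℝ) 1))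
    (hψo : ∀ u r, r ∈ Ioo (-1 : ℝ) 1 →
      0 < inner ℝ (deriv (fun r' => (ψ (u, r')).1) r) (cplxJ (deriv (fun u' => (ψ (u', r)).1) u)))
    {p₀ q₀ : ℝ × ℝ} (hq₀ : q₀.2 ∈ Ioo (-1 : ℝ) 1) (h0 : φ p₀ = ψ q₀) :
    ∃ T : ℝ × ℝ → ℝ × ℝ, T p₀ = q₀ ∧ ContDiffAt ℝ ∞ T p₀ ∧
      (∀ᶠ p in 𝓝 p₀, ψ (T p) = φ p ∧ (T p).2 ∈ Ioo (-1 : ℝ) 1) ∧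
      (fderiv ℝ (fun q : ℝ × ℝ => (ψ q).1) q₀).comp (fderiv ℝ T p₀) = fderiv ℝ (fun p : ℝ × ℝ => (φ p).1) p₀ := by
  -- the ambient maps
  set Ψ : ℝ × ℝ → EuclideanSpace ℝ (Fin 4) := fun q => (ψ q).1 with hΨ
  set Φ : ℝ × ℝ → EuclideanSpace ℝ (Fin 4) := fun p => (φ p).1 with hΦ
  have hΨs : ContDiff ℝ ∞ Ψ := contDiff_val_of_chart hψs
  have hΦs : ContDiff ℝ ∞ Φ := contDiff_val_of_chart hφs
  -- a left inverse of `DΨ(q₀)`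
  have hinj : Injective (fderiv ℝ Ψ q₀) := by
    have h := injective_fderiv_of_chart hψs hψo (u := q₀.1) hq₀
    rwa [Prod.mk.eta] at h
  obtain ⟨π, hπ⟩ := exists_leftInverse_clm _ hinj
  -- `F = π ∘ Ψ` is a local diffeomorphism at `q₀`
  set F : ℝ × ℝ → ℝ × ℝ := fun q => π (Ψ q) with hF
  have hFs : ContDiff ℝ ∞ F := π.contDiff.comp hΨs
  have hF' : HasFDerivAt F ((ContinuousLinearEquiv.refl ℝ (ℝ × ℝ) : (ℝ × ℝ) →L[ℝ] (ℝ × ℝ))) q₀ := by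
    have h := π.hasFDerivAt.comp q₀ (hΨs.differentiable (by simp) q₀).hasFDerivAt
    refine h.congr_fderiv ?_
    ext <;> simp [hπ]
  have hn : (∞ : WithTop ℕ∞) ≠ 0 := by simp
  set Fh := hFs.contDiffAt.toOpenPartialHomeomorph F hF' hn with hFh
  have hq₀s : q₀ ∈ Fh.source := hFs.contDiffAt.mem_toOpenPartialHomeomorph_source hF' hn
  have hFh_coe : (Fh : ℝ × ℝ → ℝ × ℝ) = F := hFs.contDiffAt.toOpenPartialHomeomorph_coe hF' hn
  -- points of the page near `ψ q₀` are `ψ q`, `q` near `q₀` in the source and in the open strip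
  have hN : Fh.source ∩ {q : ℝ × ℝ | q.2 ∈ Ioo (-1 : ℝ) 1} ∈ 𝓝 q₀ :=
    inter_mem (Fh.open_source.mem_nhds hq₀s) ((isOpen_Ioo.preimage continuous_snd).mem_nhds hq₀)
  obtain ⟨O, hO, hOψ⟩ := chart_relOpen hc hψs.continuous hψ1 hψp hψi hq₀ hN
  have hev : ∀ᶠ p in 𝓝 p₀, φ p ∈ O := by
    have : O ∈ 𝓝 (φ p₀) := by rwa [h0]
    exact hφs.continuous.continuousAt this
  -- the transition map
  let T : ℝ × ℝ → ℝ × ℝ := fun p => Fh.symm (π (Φ p))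
  have hT0 : T p₀ = q₀ := by
    show Fh.symm (π (Φ p₀)) = q₀
    have e : π (Φ p₀) = Fh q₀ := by rw [hFh_coe, hF, hΦ]; simp only; rw [h0]
    rw [e, Fh.left_inv hq₀s]
  have hTs : ContDiffAt ℝ ∞ T p₀ := by
    have h1 : ContDiffAt ℝ ∞ Fh.symm (F q₀) := hFs.contDiffAt.to_localInverse hF' hn
    have e : F q₀ = π (Φ p₀) := by rw [hF, hΦ]; simp only; rw [h0]
    rw [e] at h1
    exact h1.comp p₀ (π.contDiff.comp hΦs).contDiffAt
  have hTev : ∀ᶠ p in 𝓝 p₀, ψ (T p) = φ p ∧ (T p).2 ∈ Ioo (-1 : ℝ) 1 := by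
    filter_upwards [hev] with p hp
    obtain ⟨q, ⟨hqs, hq2⟩, hqψ⟩ := hOψ _ hp (hφp p)
    have eT : T p = q := by
      show Fh.symm (π (Φ p)) = q
      have e : π (Φ p) = Fh q := by rw [hFh_coe, hF, hΦ]; simp only; rw [← hqψ]
      rw [e, Fh.left_inv hqs]
    rw [eT]
    exact ⟨hqψ, hq2⟩
  refine ⟨T, hT0, hTs, hTev, ?_⟩
  -- the derivative relation from `Ψ ∘ T = Φ` near `p₀`
  have heq : (fun p => Ψ (T p)) =ᶠ[𝓝 p₀] Φ := by
    filter_upwards [hTev] with p hp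
    show (ψ (T p)).1 = (φ p).1
    rw [hp.1]
  have hTd : DifferentiableAt ℝ T p₀ := hTs.differentiableAt (by simp)
  have hcomp : HasFDerivAt (fun p => Ψ (T p)) ((fderiv ℝ Ψ q₀).comp (fderiv ℝ T p₀)) p₀ := by
    have h := (hΨs.differentiable (by simp) (T p₀)).hasFDerivAt.comp p₀ hTd.hasFDerivAt
    rwa [hT0] at h
  rw [← heq.fderiv_eq, hcomp.fderiv]

/-- **The transverse coordinate of a smooth page map relative to an annulus chart is smooth near
a point of the open annulus**, and is the second component of the transition map there. [folklore] -/
theorem contDiffAt_height_comp_chart (hc : ‖c‖ = 1) (hφs : ContMDiff 𝓘(ℝ, ℝ × ℝ) (𝓡∂ 4) ∞ φ)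
    (hφp : ∀ p, φ p ∈ page g c) (hψs : ContMDiff 𝓘(ℝ, ℝ × ℝ) (𝓡∂ 4) ∞ ψ)
    (hψ1 : ∀ u r, ψ (u + 1, r) = ψ (u, r)) (hψp : ∀ p, ψ p ∈ page g c)
    (hψi : InjOn ψ (Ico (0 : ℝ) 1 ×ˢ Ioo (-1 : ℝ) 1))
    (hψo : ∀ u r, r ∈ Ioo (-1 : ℝ) 1 →
      0 < inner ℝ (deriv (fun r' => (ψ (u, r')).1) r) (cplxJ (deriv (fun u' => (ψ (u', r)).1) u)))
    {p₀ q₀ : ℝ × ℝ} (hq₀ : q₀.2 ∈ Ioo (-1 : ℝ) 1) (h0 : φ p₀ = ψ q₀) :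
    ∃ T : ℝ × ℝ → ℝ × ℝ, T p₀ = q₀ ∧ ContDiffAt ℝ ∞ T p₀ ∧
      (∀ᶠ p in 𝓝 p₀, height ψ (φ p) = (T p).2) ∧ ContDiffAt ℝ ∞ (fun p => height ψ (φ p)) p₀ := by
  obtain ⟨T, hT0, hTs, hTev, -⟩ := exists_transition hc hφs hφp hψs hψ1 hψp hψi hψo hq₀ h0
  have hh : ∀ᶠ p in 𝓝 p₀, height ψ (φ p) = (T p).2 := by
    filter_upwards [hTev] with p hp
    rw [← hp.1, show T p = ((T p).1, (T p).2) from rfl]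
    exact height_of_lift hψ1 hψi hp.2
  refine ⟨T, hT0, hTs, hh, ?_⟩
  exact (contDiffAt_snd.comp p₀ hTs).congr_of_eventuallyEq hh

/-- **Sub-goal `helper_chart_transition`** (Z6 §3 (R1)(i) TRANSITION MAPS, a step of the symmetry
statement for node N1a of NF4): near a common point `φ p₀ = ψ q₀` of a smooth page map `φ` and an
annulus chart `ψ` (`q₀` in the open strip) there is a transition map `T`, `C^∞` at `p₀`, with
`T p₀ = q₀`, `ψ ∘ T = φ` and `(T ·).2 ∈ (−1,1)` near `p₀`, and `DΨ(q₀) ∘ DT(p₀) = DΦ(p₀)`.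
[cite: LeeSmoothManifolds2013, Thm. 4.5] -/
theorem helper_chart_transition : ∀ (g : ℕ) (c : ℂ) (_hc : ‖c‖ = 1) (φ ψ : ℝ × ℝ → Literature.Topology.FourManifolds.LefschetzBase.Base g), ContMDiff 𝓘(ℝ, ℝ × ℝ) (𝓡∂ 4) ∞ φ → (∀ p, φ p ∈ Literature.Topology.FourManifolds.LefschetzBase.page g c) → ContMDiff 𝓘(ℝ, ℝ × ℝ) (𝓡∂ 4) ∞ ψ → (∀ u r, ψ (u + 1, r) = ψ (u, r)) → (∀ p, ψ p ∈ Literature.Topology.FourManifolds.LefschetzBase.page g c) → Set.InjOn ψ (Set.Ico (0 : ℝ) 1 ×ˢ Set.Ioo (-1 : ℝ) 1) → (∀ u r, r ∈ Set.Ioo (-1 : ℝ) 1 → 0 < inner ℝ (deriv (fun r' => (ψ (u, r')).1) r) (Literature.Topology.FourManifolds.LefschetzBase.cplxJ (deriv (fun u' => (ψ (u', r)).1) u))) → ∀ (p₀ q₀ : ℝ × ℝ), q₀.2 ∈ Set.Ioo (-1 : ℝ) 1 → φ p₀ = ψ q₀ → ∃ T : ℝ × ℝ → ℝ × ℝ,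 T p₀ = q₀ ∧ ContDiffAt ℝ ∞ T p₀ ∧ (∀ᶠ p in nhds p₀, ψ (T p) = φ p ∧ (T p).2 ∈ Set.Ioo (-1 : ℝ) 1) ∧ (fderiv ℝ (fun q : ℝ × ℝ => (ψ q).1) q₀).comp (fderiv ℝ T p₀) = fderiv ℝ (fun p : ℝ × ℝ => (φ p).1) p₀ :=
  fun _ _ hc _ _ hφs hφp hψs hψ1 hψp hψi hψo _ _ hq₀ h0 => exists_transition hc hφs hφp hψs hψ1 hψp hψi hψo hq₀ h0

end Summit.SmoothPoincare4.SmoothPoincare4.Theorems.AcyclicBisectionExists.ModpBraidOrbits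

end
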